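import Mathlib
import HarnessLib
import Summits.Ventures.LatticeQCDFlow.Scoring.BlockProdMarginals

/-!
# LatticeQCDFlow / Scoring — three-coordinate marginals of an i.i.d. (block-product) law and the
# conditional factorisation over a SHARED coordinate

HONEST FRAMING: exact (Metropolis-corrected) sampling algorithms for lattice gauge theory;
figures of merit are autocorrelation/cost numbers at stated couplings and volumes; no
continuum-physics claim.

Venture `LatticeQCDFlow` (cell pub-lqcd), sub-topic `Scoring`; FANOUT row 3 (`s0-u1-a`, S0-B
implementation A, GEN-8).  NEW WORK of the cell (Fubini over three coordinates of a finite product,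
in finite-sum form), not a published result; NO definition is introduced.  The bookkeeping layer
under row 3's `Scoring/PairAcceptanceVarianceExact` (the EXACT variance of the pair-min acceptance
statistic — Hoeffding's decomposition needs the second moment over partner pairs sharing exactly
one index); it extends row 3's `Scoring/BlockProdMarginals` (imported: injective selections, four
distinct coordinates, disjoint coordinate pairs) by the three-coordinate and shared-coordinate
cases.

## Content (block-product law `blockProd qb` on `Fin m → Z`, every block `qb i` summing to `1`)

* `injective_vecCons_three`, `sum_blockProd_mul_apply₃` — `E[g₁(φ_i) g₂(φ_j) g₃(φ_k)] = Π E[g]`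
  for pairwise distinct `i, j, k`;
* `apply₃_eq_sum_ite`, `sum_blockProd_mul_apply₃'` — the same for a general integrand
  `H(φ_i, φ_j, φ_k)`: `E[H] = Σ_xΣ_yΣ_z qb_i(x) qb_j(y) qb_k(z) H(x, y, z)`;
* **`sum_blockProd_mul_apply₂_mul_apply₂_shared`** — for pairwise distinct `i, j, k` and ANY
  `F, G : Z → Z → ℝ`:
  `E[F(φ_i, φ_j)·G(φ_i, φ_k)] = Σ_x qb_i(x)·(Σ_y qb_j(y) F(x, y))·(Σ_z qb_k(z) G(x, z))` —
  given the shared coordinate the two factors are (conditionally) independent, so the mixed second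
  moment of a U-statistic kernel over two pairs sharing one index is the model mean of the SQUARED
  conditional mean of the kernel (Hoeffding's `ζ₁ + mean²`).

Elementary (`[folklore]`-level).  NOT CLAIMED: anything probabilistic beyond finite sums; no
measure-theoretic conditional-independence statement is made or needed.
-/

namespace Summit.Ventures.LatticeQCDFlow.Scoring

open Finset
open Literature.Probability.MarkovChains
open Summit.Ventures.LatticeQCDFlow.Exactness
open Summit.Ventures.LatticeQCDFlow.Theory2

/-! ### Three-coordinate marginals of a block-product law -/

section Marginals

variable {Z : Type*} [Fintype Z] {m : ℕ}

/-- Three pairwise distinct indices give an injective selection `![i, j, k]`. -/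
theorem injective_vecCons_three {i j k : Fin m} (hij : i ≠ j) (hik : i ≠ k) (hjk : j ≠ k) :
    Function.Injective ![i, j, k] := by
  intro s t h
  fin_cases s <;> fin_cases t <;> simp_all [eq_comm]

/-- **Three-coordinate product marginal**: for pairwise distinct `i, j, k`,
`E[g₁(φ_i) g₂(φ_j) g₃(φ_k)] = Π E[g]`. [folklore] -/
theorem sum_blockProd_mul_apply₃ (qb : Fin m → Z → ℝ) (hq1 : ∀ i, ∑ z, qb i z = 1)
    (g₁ g₂ g₃ : Z → ℝ) {i j k : Fin m} (hij : i ≠ j) (hik : i ≠ k) (hjk : j ≠ k) :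
    ∑ φ : Fin m → Z, blockProd qb φ * (g₁ (φ i) * g₂ (φ j) * g₃ (φ k))
      = (∑ z, qb i z * g₁ z) * (∑ z, qb j z * g₂ z) * ∑ z, qb k z * g₃ z := by
  have h := sum_blockProd_mul_prod_apply qb hq1 (injective_vecCons_three hij hik hjk) ![g₁, g₂, g₃]
  simpa [Fin.prod_univ_three, mul_assoc] using h

/-- Indicator expansion of a function of three coordinates. [folklore] -/
theorem apply₃_eq_sum_ite [DecidableEq Z] (H : Z → Z → Z → ℝ) (a b c : Z) :
    H a b c = ∑ x, ∑ y, ∑ z, H x y z *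
      ((if a = x then (1 : ℝ) else 0) * (if b = y then 1 else 0) * (if c = z then 1 else 0)) := by
  have inner : ∀ x y, ∑ z, H x y z *
      ((if a = x then (1 : ℝ) else 0) * (if b = y then 1 else 0) * (if c = z then 1 else 0))
      = H x y c * ((if a = x then (1 : ℝ) else 0) * (if b = y then 1 else 0)) := by
    intro x y
    have e : ∀ z, H x y z *
        ((if a = x then (1 : ℝ) else 0) * (if b = y then 1 else 0) * (if c = z then 1 else 0))
        = if c = z then H x y z * ((if a = x then (1 : ℝ) else 0) * (if b = y then 1 else 0))
          else 0 := by
      intro z; split_ifs <;> ring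
    simp_rw [e]
    exact Fintype.sum_ite_eq c _
  simp_rw [inner]
  exact apply₂_eq_sum_ite (fun x y => H x y c) a b

/-- **Three-coordinate marginal, general integrand**: for pairwise distinct `i, j, k` and any
`H : Z → Z → Z → ℝ`, `E[H(φ_i, φ_j, φ_k)] = Σ_x Σ_y Σ_z qb_i(x) qb_j(y) qb_k(z) H(x, y, z)`.
[folklore] -/
theorem sum_blockProd_mul_apply₃' (qb : Fin m → Z → ℝ) (hq1 : ∀ i, ∑ z, qb i z = 1)
    (H : Z → Z → Z → ℝ) {i j k : Fin m} (hij : i ≠ j) (hik : i ≠ k) (hjk : j ≠ k) :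
    ∑ φ : Fin m → Z, blockProd qb φ * H (φ i) (φ j) (φ k)
      = ∑ x, ∑ y, ∑ z, qb i x * qb j y * qb k z * H x y z := by
  classical
  have ind : ∀ (t : Fin m) (a : Z), ∑ z, qb t z * (if z = a then (1 : ℝ) else 0) = qb t a := by
    intro t a
    simp_rw [mul_ite, mul_one, mul_zero]
    exact Fintype.sum_ite_eq' a _
  have hφ : ∀ φ : Fin m → Z, blockProd qb φ * H (φ i) (φ j) (φ k)
      = ∑ x, ∑ y, ∑ z, H x y z * (blockProd qb φ *
          ((if φ i = x then (1 : ℝ) else 0) * (if φ j = y then 1 else 0)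
            * (if φ k = z then 1 else 0))) := by
    intro φ
    conv_lhs => rw [apply₃_eq_sum_ite H (φ i) (φ j) (φ k)]
    rw [mul_sum]
    refine sum_congr rfl fun x _ => ?_
    rw [mul_sum]
    refine sum_congr rfl fun y _ => ?_
    rw [mul_sum]
    refine sum_congr rfl fun z _ => ?_
    ring
  calc ∑ φ : Fin m → Z, blockProd qb φ * H (φ i) (φ j) (φ k)
      = ∑ φ : Fin m → Z, ∑ x, ∑ y, ∑ z, H x y z * (blockProd qb φ *
          ((if φ i = x then (1 : ℝ) else 0) * (if φ j = y then 1 else 0)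
            * (if φ k = z then 1 else 0))) := sum_congr rfl fun φ _ => hφ φ
    _ = ∑ x, ∑ y, ∑ z, H x y z * ∑ φ : Fin m → Z, blockProd qb φ *
          ((if φ i = x then (1 : ℝ) else 0) * (if φ j = y then 1 else 0)
            * (if φ k = z then 1 else 0)) := by
        rw [sum_comm]
        refine sum_congr rfl fun x _ => ?_
        rw [sum_comm]
        refine sum_congr rfl fun y _ => ?_
        rw [sum_comm]
        refine sum_congr rfl fun z _ => ?_
        rw [← mul_sum]
    _ = ∑ x, ∑ y, ∑ z, H x y z * (qb i x * qb j y * qb k z) := by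
        refine sum_congr rfl fun x _ => sum_congr rfl fun y _ => sum_congr rfl fun z _ => ?_
        rw [sum_blockProd_mul_apply₃ qb hq1 (fun t => if t = x then (1 : ℝ) else 0)
          (fun t => if t = y then (1 : ℝ) else 0) (fun t => if t = z then (1 : ℝ) else 0) hij hik hjk,
          ind, ind, ind]
    _ = ∑ x, ∑ y, ∑ z, qb i x * qb j y * qb k z * H x y z := by
        refine sum_congr rfl fun x _ => sum_congr rfl fun y _ => sum_congr rfl fun z _ => ?_
        ring

/-- **Conditioning on a shared coordinate**: for pairwise distinct `i, j, k` and any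
`F, G : Z → Z → ℝ`,
`E[F(φ_i, φ_j)·G(φ_i, φ_k)] = Σ_x qb_i(x) · (Σ_y qb_j(y) F(x, y)) · (Σ_z qb_k(z) G(x, z))` — given the
shared coordinate the two factors are independent. [folklore] -/
theorem sum_blockProd_mul_apply₂_mul_apply₂_shared (qb : Fin m → Z → ℝ)
    (hq1 : ∀ i, ∑ z, qb i z = 1) (F G : Z → Z → ℝ) {i j k : Fin m}
    (hij : i ≠ j) (hik : i ≠ k) (hjk : j ≠ k) :
    ∑ φ : Fin m → Z, blockProd qb φ * (F (φ i) (φ j) * G (φ i) (φ k))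
      = ∑ x, qb i x * ((∑ y, qb j y * F x y) * ∑ z, qb k z * G x z) := by
  calc ∑ φ : Fin m → Z, blockProd qb φ * (F (φ i) (φ j) * G (φ i) (φ k))
      = ∑ x, ∑ y, ∑ z, qb i x * qb j y * qb k z * (F x y * G x z) :=
        sum_blockProd_mul_apply₃' qb hq1 (fun x y z => F x y * G x z) hij hik hjk
    _ = ∑ x, qb i x * ((∑ y, qb j y * F x y) * ∑ z, qb k z * G x z) := by
        refine sum_congr rfl fun x _ => ?_
        rw [sum_mul_sum, mul_sum]
        refine sum_congr rfl fun y _ => ?_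
        rw [mul_sum]
        refine sum_congr rfl fun z _ => ?_
        ring

end Marginals

end Summit.Ventures.LatticeQCDFlow.Scoring
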